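import Summits.QuantumAdvantage.QuantumAdvantage.Theorems.MultiRingBridge
import HarnessLib

/-!
# Item 26534 `ExactnessDial.OddToAll3` PROVED — the odd ⟹ all dictionary for inverse-polynomial loss

Cell decomp-qadv, seat lens-2, generation 12 (stand-alone land file; the same proof sits in the node
`HOME/decomp-qadv-lens-2/g12/LeaderDial.lean` as `LeaderDial.oddToAll3`).  No new `Prop`, explicit binders.

`Theses.ExactnessDial.OddToAll3 : PolyLossOddU3 → PolyLoss3` (stmt-QuantumAdvantage-26534, shared verbatim by
ProductDial / WildDial / SupportDial): an odd-class loss of `2^(n−1)/n^C` against polylog-degree `𝔽₃` strategies is an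
all-pattern loss of `≥ 2^n/n^(C+1)` (`k := C + 1`, threshold `max n₀ 2`), because the odd class has at least
`2^(n−1)` patterns (`two_pow_le_card_odd`, from the tree's `card_even_class_le`).  Corollary `exactnessDial_closes₂ :
PolyLossOddU3 → DPLift3 → AdviceFreeQNC0Three` — ExactnessDial's `closes` with `NoPerfectOdd3` (from the junction),
`MassStep3u` (trivial from the junction), `OddToAll3` (this file) and the bridge (`exactnessDial_multiRingBridge3`)
all discharged.
-/

set_option linter.dupNamespace false

noncomputable section

open scoped Classical

namespace Summit.QuantumAdvantage.QuantumAdvantage.Theorems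

open Finset
open Literature.Computability.QuantumComplexity Literature.Computability.QuantumComplexity.RingHLF
open Literature.Computability.MetaComplexity Literature.Computability.MetaComplexity.Smolensky
open Summit.QuantumAdvantage.AdviceFreeQNC0

namespace ExactnessDialOddToAll

/-- at least `2^(n−1)` patterns of the `n`-cube (`n ≥ 1`) have an odd number of zeros (flipping bit `0`
injects the even class into the odd class; tree `card_even_class_le`). -/
theorem two_pow_le_card_odd {m : ℕ} :
    2 ^ m ≤ (univ.filter fun x : Fin (m + 1) → Bool => OddZeros x).card := by
  have htot := Finset.card_filter_add_card_filter_not (s := (univ : Finset (Fin (m + 1) → Bool)))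
    (fun x => (univ.filter fun j : Fin (m + 1) => x j = false).card % 2 = 1)
  rw [card_univ, Fintype.card_fun, Fintype.card_bool, Fintype.card_fin, pow_succ] at htot
  have heven : (univ.filter fun x : Fin (m + 1) → Bool =>
      ¬ (univ.filter fun j : Fin (m + 1) => x j = false).card % 2 = 1).card ≤ 2 ^ m := by
    convert card_even_class_le (n := m) using 3
  have e : (univ.filter fun x : Fin (m + 1) → Bool => OddZeros x) =
      univ.filter fun x : Fin (m + 1) → Bool =>
        (univ.filter fun j : Fin (m + 1) => x j = false).card % 2 = 1 := by
    ext x; simp only [mem_filter, OddZeros]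
  rw [e]
  omega

/-- arithmetic core of the odd ⟹ all dictionary: `S ≤ (1 − A)·T`, `R + T ≤ S + 2T`, `0 ≤ A(1 − 2a)T` give
`R ≤ (1 − A·a)·2T`. -/
theorem oddToAll_arith (R S T A a : ℝ) (h1 : S ≤ (1 - A) * T) (h2 : R + T ≤ S + T * 2)
    (h3 : 0 ≤ A * (1 - 2 * a) * T) : R ≤ (1 - A * a) * (T * 2) := by
  nlinarith

/-- **Item 26534 `ExactnessDial.OddToAll3` PROVED** (the odd ⟹ all dictionary; `k := C + 1`, threshold
`max n₀ 2`): the odd class has at least `2^(n−1)` patterns (`two_pow_le_card_odd`), so the even class has at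
most `2^(n−1)`, and an odd-class loss of `2^(n−1)/n^C` is an all-pattern loss of at least `2^n/n^(C+1)`
once `n ≥ 2`.  (Closes the shared aside item 26534 by exact type.) -/
theorem exactnessDial_oddToAll3 : Theses.ExactnessDial.OddToAll3 := by
  rintro ⟨C, hC⟩
  refine ⟨C + 1, fun c => ?_⟩
  obtain ⟨n₀, hn₀⟩ := hC c
  refine ⟨max n₀ 2, fun n hn P hP => ?_⟩
  have hn2 : 2 ≤ n := le_trans (le_max_right _ _) hn
  have hodd := hn₀ n (le_trans (le_max_left _ _) hn) P hP
  obtain ⟨m, rfl⟩ : ∃ m, n = m + 1 := ⟨n - 1, by omega⟩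
  rw [show m + 1 - 1 = m from rfl] at hodd
  -- counting in ℕ: `#Rel + 2^m ≤ #(Odd ∧ Rel) + 2^(m+1)`
  have hsplit := Finset.card_filter_add_card_filter_not
    (s := univ.filter fun x : Fin (m + 1) → Bool => RingHLF.Rel x (fun i => decide (P i x = 1)))
    (fun x => OddZeros x)
  have h1 : ((univ.filter fun x : Fin (m + 1) → Bool =>
      RingHLF.Rel x (fun i => decide (P i x = 1))).filter fun x => OddZeros x) =
      univ.filter fun x : Fin (m + 1) → Bool =>
        OddZeros x ∧ RingHLF.Rel x (fun i => decide (P i x = 1)) := by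
    ext x
    simp only [mem_filter, mem_univ, true_and, and_comm]
  have h2 : ((univ.filter fun x : Fin (m + 1) → Bool =>
      RingHLF.Rel x (fun i => decide (P i x = 1))).filter fun x => ¬ OddZeros x) ⊆
      univ.filter fun x : Fin (m + 1) → Bool => ¬ OddZeros x := by
    intro x hx
    rw [mem_filter] at hx ⊢
    exact ⟨mem_univ _, hx.2⟩
  have hcomp := Finset.card_filter_add_card_filter_not (s := (univ : Finset (Fin (m + 1) → Bool)))
    (fun x => OddZeros x)
  rw [card_univ, Fintype.card_fun, Fintype.card_bool, Fintype.card_fin] at hcomp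
  have hlow := two_pow_le_card_odd (m := m)
  have h2c := card_le_card h2
  rw [h1] at hsplit
  have e2 : 2 ^ (m + 1) = 2 ^ m * 2 := pow_succ 2 m
  have hnat : (univ.filter fun x : Fin (m + 1) → Bool =>
      RingHLF.Rel x (fun i => decide (P i x = 1))).card + 2 ^ m ≤
      (univ.filter fun x : Fin (m + 1) → Bool =>
        OddZeros x ∧ RingHLF.Rel x (fun i => decide (P i x = 1))).card + 2 ^ m * 2 := by
    omega
  have hR : ((univ.filter fun x : Fin (m + 1) → Bool =>
      RingHLF.Rel x (fun i => decide (P i x = 1))).card : ℝ) + (2 : ℝ) ^ m ≤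
      ((univ.filter fun x : Fin (m + 1) → Bool =>
        OddZeros x ∧ RingHLF.Rel x (fun i => decide (P i x = 1))).card : ℝ) + (2 : ℝ) ^ m * 2 := by
    exact_mod_cast hnat
  -- real arithmetic with `a := 1/n ≤ 1/2`
  have h2le : (2 : ℝ) ≤ ((m + 1 : ℕ) : ℝ) := by exact_mod_cast hn2
  have hapos : (0 : ℝ) < 1 / ((m + 1 : ℕ) : ℝ) := by positivity
  have ha : 1 / ((m + 1 : ℕ) : ℝ) ≤ 1 / 2 := one_div_le_one_div_of_le (by norm_num) h2le
  rw [← one_div_pow] at hodd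
  rw [← one_div_pow, pow_succ (1 / ((m + 1 : ℕ) : ℝ)) C, pow_succ (2 : ℝ) m]
  refine oddToAll_arith _ _ _ _ _ hodd hR ?_
  have hA : (0 : ℝ) ≤ (1 / ((m + 1 : ℕ) : ℝ)) ^ C := pow_nonneg hapos.le C
  have hB : (0 : ℝ) ≤ 1 - 2 * (1 / ((m + 1 : ℕ) : ℝ)) := by linarith
  exact mul_nonneg (mul_nonneg hA hB) (pow_nonneg (by norm_num) m)

/-- a win count `≤ (1 − n^(−C))·2^(n−1)` on the odd class leaves an odd loser (`n ≥ 1`). -/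
theorem exists_odd_loser {n C : ℕ} (hn : 1 ≤ n) (z : (Fin n → Bool) → Fin n → Bool)
    (h : ((univ.filter fun x : Fin n → Bool => OddZeros x ∧ RingHLF.Rel x (z x)).card : ℝ) ≤
      (1 - 1 / (n : ℝ) ^ C) * (2 : ℝ) ^ (n - 1)) :
    ∃ x : Fin n → Bool, OddZeros x ∧ ¬ RingHLF.Rel x (z x) := by
  by_contra hall
  push Not at hall
  have hsub : (univ.filter fun x : Fin n → Bool => OddZeros x) ⊆
      univ.filter fun x : Fin n → Bool => OddZeros x ∧ RingHLF.Rel x (z x) := by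
    intro x hx
    rw [mem_filter] at hx ⊢
    exact ⟨hx.1, hx.2, hall x hx.2⟩
  obtain ⟨m, rfl⟩ : ∃ m, n = m + 1 := ⟨n - 1, by omega⟩
  have hodd := two_pow_le_card_odd (m := m)
  have hle : (2 : ℝ) ^ m ≤
      ((univ.filter fun x : Fin (m + 1) → Bool => OddZeros x ∧ RingHLF.Rel x (z x)).card : ℝ) := by
    exact_mod_cast hodd.trans (card_le_card hsub)
  have hpos : (0 : ℝ) < 1 / ((m + 1 : ℕ) : ℝ) ^ C := by positivity
  have h2 : (0 : ℝ) < (2 : ℝ) ^ m := by positivity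
  rw [show m + 1 - 1 = m from rfl] at h
  nlinarith

/-- `PolyLossOddU3 → NoPerfectOdd3` (26531 ⟹ 26532; loss forbids perfection). -/
theorem noPerfectOdd3_of_polyLossOddU3 (h : Theses.ExactnessDial.PolyLossOddU3) :
    Theses.ExactnessDial.NoPerfectOdd3 := by
  obtain ⟨C, hC⟩ := h
  intro c
  obtain ⟨n₀, hn₀⟩ := hC c
  refine ⟨max n₀ 1, fun n hn P hP => ?_⟩
  exact exists_odd_loser (le_trans (le_max_right _ _) hn) (fun x i => decide (P i x = 1))
    (hn₀ n (le_trans (le_max_left _ _) hn) P hP)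

/-- ExactnessDial's `closes` from the JUNCTION `PolyLossOddU3` (26531) and the declared residual `DPLift3`
(26124) ALONE: `NoPerfectOdd3` (`noPerfectOdd3_of_polyLossOddU3`), `MassStep3u` (trivially), `OddToAll3`
(`exactnessDial_oddToAll3`) and the bridge (`exactnessDial_multiRingBridge3`) are discharged. -/
theorem exactnessDial_closes₂ (hPL : Theses.ExactnessDial.PolyLossOddU3) (hD : Theses.ExactnessDial.DPLift3) :
    Summit.QuantumAdvantage.AdviceFreeQNC0.AdviceFreeQNC0Three :=
  exactnessDial_closes₄ (noPerfectOdd3_of_polyLossOddU3 hPL) (fun _ => hPL) exactnessDial_oddToAll3 hD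

end ExactnessDialOddToAll

end Summit.QuantumAdvantage.QuantumAdvantage.Theorems
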